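import Mathlib
import HarnessLib
import Literature.Computability.AlgebraicComplexity.PatternExpressions
import Summits.ValiantsHypothesis.ValiantsHypothesis.Theorems.MonotoneRestorationMonotoneRestorationQPLinearWidthDefs
import Summits.ValiantsHypothesis.ValiantsHypothesis.Theorems.MonotoneRestorationMonotoneRestorationQPLinearWidthCFIHomMonotone
import Summits.ValiantsHypothesis.ValiantsHypothesis.Theorems.MonotoneRestorationOrbitRestorationQPSimpleGraphCut

/-!
# Route MonotoneRestoration, crux `MonotoneRestorationQP` (stmt-15886), line `linear_width` —
# THE RETRACT WITNESSES IN THE LINE'S WEIGHTED CURRENCY (`HomIndist`-pairs separating `hom_E`)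

Helper file (`--supports stmt-ValiantsHypothesis-15886`), def-free.  Companion of `CFIHomMonotone` (p841399).

The isolation lemmas of the line (`IsolationAnyLevel.mem_narrowSpan_of_determined_of_distinguishable_le`, p840908;
`qpOrbit_of_matrixSymmetric_of_smallDistinguishable`) consume, per wide pattern `E`, a witness of the shape
`∃ z z' : Fin ν × Fin ν → ℂ, HomIndist ν k z z' ∧ eval z (homPoly E ν ℂ) ≠ eval z' (homPoly E ν ℂ)`.
By the tree's dictionary (`SimpleGraphCut.eval_indicator_homPoly`: `hom_E` at the `0/1` adjacency matrix of a simple graph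
counts homomorphisms from `patternGraph E`; `SimpleGraphCut.homIndist_indicator_of_ckEquiv`: `C^k`-equivalent hosts give
`HomIndist`-related matrices, Dvořák PROVED in the tree) the unconditional simple-graph witnesses of `CFIHomMonotone` become
witnesses of exactly that shape:

* `exists_homIndist_witness_of_ckEquiv` — any `C^k`-equivalent pair of hosts on `Fin m` with different homomorphism counts
  from `patternGraph E` yields a `HomIndist m k` pair of points of `ℂ^{m×m}` separated by `hom_E`;
* `exists_homIndist_witness_of_retract` — **for every bipartite pattern `E` whose pattern graph retracts onto the
  2-subdivision `G₂` of a connected base `G` with `tw G ≥ k ≥ 1`**, such a pair exists at level `ν = |CFI(G)|`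
  (`≤ v·2^Δ + 2vΔ`, `CFIHomMonotone.card_cfiVertex_le`) — UNCONDITIONALLY (Chen–Flum–Liu's havens + the retract strictness);
* `exists_homIndist_witness_of_gridRetract` — the grid instance: level `ν = |CFI(grid k k)| = O(k²)`.

Honest label: these isolate, inside a determined expansion, exactly the wide patterns that RETRACT onto a 2-subdivided wide
base (e.g. subdivided grids with pendant trees); general sparse wide patterns need the apexed pair ((P3)/(P4) of the g13
census) and dense ones (`K_{d,d}`) another witness family.  No stub closed; θ₁, the cruxes and VP ≠ VNP NOT moved.
[cite: ChenFlumLiu2025, Thm 11.1, Thm 12.2; Dvorak2010, Thm 6; DawarPagoSeppelt2025, §7.1.1]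
-/

set_option linter.dupNamespace false

noncomputable section

open scoped Classical

namespace Summit.ValiantsHypothesis.ValiantsHypothesis.Theorems.CFIHomMonotone

open MvPolynomial
open Literature.ModelTheory.FiniteModelTheory Literature.ModelTheory.FiniteModelTheory.ChenFlumLiu2025
open Literature.Computability.AlgebraicComplexity
open Summit.ValiantsHypothesis.ValiantsHypothesis.Theorems.MonotoneRestorationQPLinearWidth

variable {v : ℕ} {G : SimpleGraph (Fin v)} [DecidableRel G.Adj]

/-- **Simple-graph witness ⇒ weighted witness.**  Two `C^k`-equivalent hosts on `Fin m` with different numbers of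
homomorphisms from `patternGraph E` give two `HomIndist m k`-related points of `ℂ^{m×m}` (their `0/1` adjacency matrices)
at which `hom_E` takes different values. [cite: Dvorak2010, Thm 6; DawarPagoSeppelt2025, §7.1.1] -/
theorem exists_homIndist_witness_of_ckEquiv {a b m k : ℕ} (E : Multiset (Fin a × Fin b))
    {X Y : SimpleGraph (Fin m)} (hXY : CkEquiv k X Y)
    (hne : Nat.card (patternGraph E →g X) ≠ Nat.card (patternGraph E →g Y)) :
    ∃ z z' : Fin m × Fin m → ℂ, HomIndist m k z z' ∧ eval z (homPoly E m ℂ) ≠ eval z' (homPoly E m ℂ) := by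
  refine ⟨_, _, SimpleGraphCut.homIndist_indicator_of_ckEquiv hXY, ?_⟩
  rw [SimpleGraphCut.eval_indicator_homPoly, SimpleGraphCut.eval_indicator_homPoly]
  exact_mod_cast hne

/-- **WEIGHTED WITNESSES FOR RETRACTS OF 2-SUBDIVIDED WIDE BASES (unconditional).**  Let `G` be connected on `≥ 2`
vertices with `tw G ≥ k ≥ 1` and an edge, and let the pattern graph of `E` retract onto `G₂ = subdiv G`.  Then at level
`ν = |CFI(G)|` there are `HomIndist ν k`-related points `z, z'` of `ℂ^{ν×ν}` with `hom_E(z) ≠ hom_E(z')` — the shape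
consumed by `IsolationAnyLevel.mem_narrowSpan_of_determined_of_distinguishable_le`.
[cite: ChenFlumLiu2025, Thm 11.1, Thm 12.2; Dvorak2010, Thm 6] -/
theorem exists_homIndist_witness_of_retract {a b k : ℕ} (E : Multiset (Fin a × Fin b))
    (hconn : G.Connected) (h2 : 2 ≤ v) (hk : 1 ≤ k)
    (htw : k ≤ Literature.Combinatorics.SimpleGraph.treewidth G) (hE : G.edgeSet.Nonempty)
    (ι : subdiv G →g patternGraph E) (ρ : patternGraph E →g subdiv G) (hρι : ∀ x, ρ (ι x) = x) :
    ∃ (ν : ℕ) (z z' : Fin ν × Fin ν → ℂ), ν = Fintype.card (CFIVertex G) ∧ HomIndist ν k z z' ∧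
      eval z (homPoly E ν ℂ) ≠ eval z' (homPoly E ν ℂ) := by
  obtain ⟨m, X, Y, hm, hXY, hlt⟩ :=
    exists_fin_witness_of_retract (patternGraph E) hconn h2 hk htw hE ι ρ hρι
  obtain ⟨z, z', hzz', hne⟩ := exists_homIndist_witness_of_ckEquiv E hXY hlt.ne'
  exact ⟨m, z, z', hm, hzz', hne⟩

/-- **The grid instance in weighted currency**: for `k ≥ 1` and every pattern `E` whose pattern graph retracts onto the
2-subdivision of the `(k+1) × (k+1)` grid (on `Fin ((k+1)²)`), a `HomIndist ν k`-pair separating `hom_E` exists at level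
`ν = |CFI(grid)| = O(k²)`. [cite: ChenFlumLiu2025, Thm 11.1, Thm 12.2; BondyMurty2008, §10.5] -/
theorem exists_homIndist_witness_of_gridRetract {a b k : ℕ} (E : Multiset (Fin a × Fin b)) (hk : 1 ≤ k)
    (ι : subdiv ((Literature.Combinatorics.SimpleGraph.grid k k).map
        (Fintype.equivFin (Fin (k + 1) × Fin (k + 1))).toEmbedding) →g patternGraph E)
    (ρ : patternGraph E →g subdiv ((Literature.Combinatorics.SimpleGraph.grid k k).map
        (Fintype.equivFin (Fin (k + 1) × Fin (k + 1))).toEmbedding))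
    (hρι : ∀ x, ρ (ι x) = x) :
    ∃ (ν : ℕ) (z z' : Fin ν × Fin ν → ℂ),
      ν = Fintype.card (CFIVertex ((Literature.Combinatorics.SimpleGraph.grid k k).map
        (Fintype.equivFin (Fin (k + 1) × Fin (k + 1))).toEmbedding)) ∧
      HomIndist ν k z z' ∧ eval z (homPoly E ν ℂ) ≠ eval z' (homPoly E ν ℂ) := by
  obtain ⟨m, X, Y, hm, hXY, hlt⟩ := exists_fin_witness_of_gridRetract (patternGraph E) hk ι ρ hρι
  obtain ⟨z, z', hzz', hne⟩ := exists_homIndist_witness_of_ckEquiv E hXY hlt.ne'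
  exact ⟨m, z, z', hm, hzz', hne⟩

end Summit.ValiantsHypothesis.ValiantsHypothesis.Theorems.CFIHomMonotone

end
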